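import Literature.NumberTheory.LFunctions.TwistedConeIntegral
import Literature.NumberTheory.LFunctions.RayClassCosetReps
import Literature.NumberTheory.LFunctions.TwistedDedekindCoefficients
import Literature.NumberTheory.LFunctions.CoprimeIdealHarmonicSum
import Mathlib.NumberTheory.NumberField.Units.Basic
import HarnessLib

/-!
# Cone characters: Grössencharaktere of conductor `1` of a totally real field, on the ideals

Topic `Literature/NumberTheory/LFunctions`, sequel of `TwistedConeCount.lean` / `TwistedConeIntegral.lean`
(the twist `e_m(x) = exp(2πi m·c(x))` of a point of the mixed space through its cone coordinates,
and the twisted lattice sums over the sign parts of Mathlib's fundamental cone) and of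
`TwistedDedekindCoefficients.lean` (a character `ν : Ideal (𝓞 K) →*₀ ℂ` on the ideals and the
Dirichlet coefficients `twistCount ν n = ∑_{N𝔞 = n} ν(𝔞)` of `L(s, ν)`). Everything here is PROVED.

A **cone character of frequency `m`** (`IsConeChar ν m`) is a character of the nonzero ideals with
`|ν| = 1` whose value on a principal ideal with a TOTALLY POSITIVE generator `β` is the twist
`e_m(ι β)` — Hecke's Grössencharaktere `λ(𝔞)` of conductor `1` for a totally real field
(E. Hecke, Math. Z. 6 (1920), §1: "`λ(μ) = e^{2πi ∑ …}`" on the numbers, extended to the ideals;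
T. Mitsui, *Generalized prime number theorem*, Jap. J. Math. 26 (1956), §1). This file reduces the
partial sums `∑_{N𝔞 ≤ x} ν(𝔞)` of such a character to the twisted lattice sums of
`TwistedConeCount`:

* `IsConeChar`, `eTwist_mul` (the twist is multiplicative), `thetaVal`, `signTheta` and
  **`apply_span_eq_signTheta_mul`** — on EVERY principal ideal `(β)`, `β ≠ 0`,
  `ν((β)) = Θ_ν(signs of β) · e_m(ι β)` with a sign factor `Θ_ν ∈ {±1}` depending only on the signs
  of the conjugates of `β` (the square trick `Θ(β)² = Θ(β²)·… = 1`);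
* `torsion_eq_one_or_neg_one` — the roots of unity of a field with a real place are `±1`;
* `conePts J X` — the generators in the fundamental cone of the principal ideals `⊆ J` of norm `≤ X`,
  and `sum_conePts_eq_two_mul_sum` — they cover each such ideal exactly twice (`±β`);
* `mem_smul_signPart_iff` — the dilated sign part `t • X_s` of the cone in terms of the norm and the
  signs; `sum_conePts_filter_eq` — the cone points of given signs are the lattice points of `ι(J)` in
  `X^{1/d} • X_s`;
* the class decomposition `sum_idealsLE_eq_sum_classes` (`𝔞 ↦ 𝔞 J_C` onto the principal ideals
  `⊆ J_C`, `J_C ∈ C⁻¹`) and the resulting **`sum_twistCount_eq`**: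
  `∑_{n ≤ x} twistCount ν n = ∑_C conj ν(J_C) · ½ ∑_s Θ_ν(s) ∑_{ℓ ∈ ι(J_C) ∩ (xN J_C)^{1/d} X_s} e_m(ℓ)`.

## References

* E. Hecke, *Eine neue Art von Zetafunktionen und ihre Beziehungen zur Verteilung der Primzahlen
  II*, Math. Z. 6 (1920), 11–51, §§1–2. [HeckeMathZ1920]
* T. Mitsui, *Generalized prime number theorem*, Jap. J. Math. 26 (1956), 1–42, §1. [cite: Mitsui1956, §1]
* D. A. Marcus, *Number Fields*, 2nd ed. (2018), Ch. 6, Theorem 39 and its proof (ideals of a class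
  `↔` principal ideals divisible by a fixed ideal `↔` cone points). [Marcus2018]

## Mathlib / tree search

Mathlib: `fundamentalCone.exists_unit_smul_mem`, `unit_smul_mem_iff_mem_torsion`,
`torsion_smul_mem_of_mem`, `IsPrimitiveRoot.nrRealPlaces_eq_zero_of_two_lt`, `signSet`,
`mem_idealLattice`, `ClassGroup.mk0_eq_mk0_inv_iff`, `ClassGroup.mk0_surjective`,
`ClassGroup.mk0_eq_one_iff`, `Finset.sum_comp`, `Finset.sum_fiberwise_of_maps_to`. Tree:
`twistCount`, `idealsOfNorm` (`TwistedDedekindCoefficients`, `DedekindZetaVonMangoldt`), `idealsLE`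
(`CoprimeIdealHarmonicSum`), `eTwist`, `signPart`, `coneCoord` (`TwistedConeCount`).
-/

noncomputable section

open NumberField NumberField.InfinitePlace NumberField.mixedEmbedding
  NumberField.mixedEmbedding.fundamentalCone NumberField.Units NumberField.Units.dirichletUnitTheorem
  MeasureTheory Module Set Finset Complex Bornology
open scoped Real NNReal Pointwise Classical nonZeroDivisors ComplexConjugate NumberField

namespace Literature.NumberTheory.LFunctions.HeckeCone

variable {K : Type*} [Field K] [NumberField K]

/-! ## Total positivity (the tree's `NumberField.IsTotPos`) and the twist on products -/

omit [NumberField K] in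
/-- The real coordinates of the embedding of a nonzero element are nonzero. [folklore] -/
theorem fst_mixedEmbedding_ne_zero {x : K} (hx : x ≠ 0) (w : {w : InfinitePlace K // IsReal w}) :
    (mixedEmbedding K x).1 w ≠ 0 := by
  rw [mixedEmbedding_apply_isReal]; exact (map_ne_zero _).mpr hx

omit [NumberField K] in
/-- Two nonzero elements with the same signs have a totally positive product. [folklore] -/
theorem isTotPos_mul_of_signSet_eq {x y : K} (hx : x ≠ 0) (hy : y ≠ 0)
    (h : signSet (mixedEmbedding K x) = signSet (mixedEmbedding K y)) : NumberField.IsTotPos K (x * y) := by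
  intro w
  rw [map_mul, Prod.fst_mul, Pi.mul_apply]
  have hxw := fst_mixedEmbedding_ne_zero hx w
  have hyw := fst_mixedEmbedding_ne_zero hy w
  have hiff : (mixedEmbedding K x).1 w ≤ 0 ↔ (mixedEmbedding K y).1 w ≤ 0 := by
    have := Set.ext_iff.1 h w
    simpa [signSet] using this
  rcases lt_or_gt_of_ne hxw with hxn | hxp
  · have hyn : (mixedEmbedding K y).1 w < 0 := lt_of_le_of_ne (hiff.1 hxn.le) hyw
    exact mul_pos_of_neg_of_neg hxn hyn
  · have hyp : 0 < (mixedEmbedding K y).1 w := by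
      by_contra hle; push Not at hle
      exact absurd (hiff.2 hle) (not_le.2 hxp)
    exact mul_pos hxp hyp

/-- The cone coordinates are additive on products (nonzero norms). [folklore] -/
theorem coneCoord_mul {x y : mixedSpace K} (hx : mixedEmbedding.norm x ≠ 0) (hy : mixedEmbedding.norm y ≠ 0) :
    coneCoord (x * y) = coneCoord x + coneCoord y := by
  unfold coneCoord
  ext i
  rw [logMap_mul hx hy, map_add]
  rfl

/-- **The twist is multiplicative**: `e_m(xy) = e_m(x) e_m(y)` for `x, y` of nonzero norm.
[cite: HeckeMathZ1920, §1] -/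
theorem eTwist_mul (m : Fin (rank K) → ℝ) {x y : mixedSpace K} (hx : mixedEmbedding.norm x ≠ 0)
    (hy : mixedEmbedding.norm y ≠ 0) : eTwist m (x * y) = eTwist m x * eTwist m y := by
  unfold eTwist
  rw [← Complex.exp_add, coneCoord_mul hx hy]
  congr 1
  have hsum : ∑ i, m i * (coneCoord x + coneCoord y) i = ∑ i, m i * coneCoord x i + ∑ i, m i * coneCoord y i := by
    rw [← Finset.sum_add_distrib]
    exact Finset.sum_congr rfl fun i _ ↦ by rw [Pi.add_apply, mul_add]
  rw [hsum]
  push_cast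
  ring

/-- `e_m(x)` times its conjugate is `1`. [folklore] -/
theorem eTwist_mul_conj (m : Fin (rank K) → ℝ) (x : mixedSpace K) : eTwist m x * conj (eTwist m x) = 1 := by
  rw [Complex.mul_conj, Complex.normSq_eq_norm_sq, norm_eTwist]; norm_num

/-- The norm of the embedding of a nonzero element is nonzero. [folklore] -/
theorem norm_mixedEmbedding_ne_zero {x : K} (hx : x ≠ 0) : mixedEmbedding.norm (mixedEmbedding K x) ≠ 0 := by
  rw [norm_eq_norm, ne_eq, Rat.cast_eq_zero, abs_eq_zero, Algebra.norm_eq_zero_iff]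
  exact hx

/-! ## Cone characters -/

variable (K) in
/-- **A cone character of frequency `m`** (a Grössencharakter of conductor `1` of a totally real
field, on the ideals): `ν` is a character of the nonzero ideals with `|ν(𝔞)| = 1`, and on a principal
ideal with a totally positive generator `β` its value is the twist `e_m(ι β)` of the embedding of
`β` (Hecke: `λ(μ) = exp(2πi ∑_q m_q …(log|μ^{(q)}|))`). [cite: HeckeMathZ1920, §1] -/
structure IsConeChar (ν : Ideal (𝓞 K) →*₀ ℂ) (m : Fin (rank K) → ℝ) : Prop where
  /-- unimodular off the zero ideal -/
  norm_eq_one : ∀ I : Ideal (𝓞 K), I ≠ ⊥ → ‖ν I‖ = 1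
  /-- the value on a principal ideal with a totally positive generator -/
  apply_span_eq : ∀ β : 𝓞 K, β ≠ 0 → NumberField.IsTotPos K (β : K) →
    ν (Ideal.span {β}) = eTwist m (mixedEmbedding K (β : K))

namespace IsConeChar

variable {ν : Ideal (𝓞 K) →*₀ ℂ} {m : Fin (rank K) → ℝ}

/-- `|ν| ≤ 1` everywhere. [folklore] -/
theorem norm_le_one (h : IsConeChar K ν m) (I : Ideal (𝓞 K)) : ‖ν I‖ ≤ 1 := by
  by_cases hI : I = ⊥
  · rw [hI, NumberField.map_bot, norm_zero]; exact zero_le_one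
  · exact (h.norm_eq_one I hI).le

/-- `ν(𝔞) conj ν(𝔞) = 1` for `𝔞 ≠ 0`. [folklore] -/
theorem mul_conj_eq_one (h : IsConeChar K ν m) {I : Ideal (𝓞 K)} (hI : I ≠ ⊥) : ν I * conj (ν I) = 1 := by
  rw [Complex.mul_conj, Complex.normSq_eq_norm_sq, h.norm_eq_one I hI]; norm_num

end IsConeChar

/-- The sign factor of `β ≠ 0`: `θ(β) = ν((β)) · conj e_m(ι β)`. [folklore] -/
def thetaVal (ν : Ideal (𝓞 K) →*₀ ℂ) (m : Fin (rank K) → ℝ) (β : 𝓞 K) : ℂ :=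
  ν (Ideal.span {β}) * conj (eTwist m (mixedEmbedding K (β : K)))

/-- **The square trick**: `θ(β)² = 1` for `β ≠ 0` (`β²` is totally positive). [cite: Mitsui1956, §1] -/
theorem thetaVal_sq {ν : Ideal (𝓞 K) →*₀ ℂ} {m : Fin (rank K) → ℝ} (h : IsConeChar K ν m) {β : 𝓞 K}
    (hβ : β ≠ 0) : thetaVal ν m β ^ 2 = 1 := by
  have hβK : (β : K) ≠ 0 := RingOfIntegers.coe_ne_zero_iff.mpr hβ
  have hn := norm_mixedEmbedding_ne_zero (K := K) hβK
  have hsq := h.apply_span_eq (β * β) (mul_ne_zero hβ hβ) (by push_cast; rw [← pow_two]; exact NumberField.isTotPos_sq hβK)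
  rw [← Ideal.span_singleton_mul_span_singleton, map_mul] at hsq
  push_cast at hsq
  rw [map_mul, eTwist_mul m hn hn] at hsq
  unfold thetaVal
  calc (ν (Ideal.span {β}) * conj (eTwist m (mixedEmbedding K (β : K)))) ^ 2
      = (ν (Ideal.span {β}) * ν (Ideal.span {β})) * (conj (eTwist m (mixedEmbedding K (β : K)))) ^ 2 := by ring
    _ = (eTwist m (mixedEmbedding K (β : K)) * conj (eTwist m (mixedEmbedding K (β : K)))) ^ 2 := by
        rw [hsq]; ring
    _ = 1 := by rw [eTwist_mul_conj, one_pow]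

/-- **`θ` only depends on the signs**: `θ(β) = θ(β')` when `β, β' ≠ 0` have the same signs (their
product is totally positive, so `θ(β)θ(β') = 1`, and both square to `1`). [cite: Mitsui1956, §1] -/
theorem thetaVal_eq_of_signSet_eq {ν : Ideal (𝓞 K) →*₀ ℂ} {m : Fin (rank K) → ℝ} (h : IsConeChar K ν m)
    {β β' : 𝓞 K} (hβ : β ≠ 0) (hβ' : β' ≠ 0)
    (hs : signSet (mixedEmbedding K (β : K)) = signSet (mixedEmbedding K (β' : K))) :
    thetaVal ν m β = thetaVal ν m β' := by
  have hβK : (β : K) ≠ 0 := RingOfIntegers.coe_ne_zero_iff.mpr hβ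
  have hβK' : (β' : K) ≠ 0 := RingOfIntegers.coe_ne_zero_iff.mpr hβ'
  have hn := norm_mixedEmbedding_ne_zero (K := K) hβK
  have hn' := norm_mixedEmbedding_ne_zero (K := K) hβK'
  have hprod := h.apply_span_eq (β * β') (mul_ne_zero hβ hβ')
    (by push_cast; exact isTotPos_mul_of_signSet_eq hβK hβK' hs)
  rw [← Ideal.span_singleton_mul_span_singleton, map_mul] at hprod
  push_cast at hprod
  rw [map_mul, eTwist_mul m hn hn'] at hprod
  have hab : thetaVal ν m β * thetaVal ν m β' = 1 := by
    unfold thetaVal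
    calc ν (Ideal.span {β}) * conj (eTwist m (mixedEmbedding K (β : K))) *
          (ν (Ideal.span {β'}) * conj (eTwist m (mixedEmbedding K (β' : K))))
        = (ν (Ideal.span {β}) * ν (Ideal.span {β'})) *
            (conj (eTwist m (mixedEmbedding K (β : K))) * conj (eTwist m (mixedEmbedding K (β' : K)))) := by ring
      _ = (eTwist m (mixedEmbedding K (β : K)) * conj (eTwist m (mixedEmbedding K (β : K)))) *
            (eTwist m (mixedEmbedding K (β' : K)) * conj (eTwist m (mixedEmbedding K (β' : K)))) := by
          rw [hprod]; ring
      _ = 1 := by rw [eTwist_mul_conj, eTwist_mul_conj, one_mul]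
  have ha := thetaVal_sq h hβ
  have hb := thetaVal_sq h hβ'
  -- `a² = 1`, `b² = 1`, `ab = 1` ⇒ `a = b`
  calc thetaVal ν m β = thetaVal ν m β * thetaVal ν m β' ^ 2 := by rw [hb, mul_one]
    _ = (thetaVal ν m β * thetaVal ν m β') * thetaVal ν m β' := by ring
    _ = thetaVal ν m β' := by rw [hab, one_mul]

/-- **The sign character `Θ_ν(s)`** of a sign pattern `s` (a set of real places): `θ(β)` for any
`β ≠ 0` in `𝓞 K` with negative conjugates exactly at `s` (`0` if there is none).
[cite: Mitsui1956, §1] -/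
def signTheta (ν : Ideal (𝓞 K) →*₀ ℂ) (m : Fin (rank K) → ℝ)
    (s : Set {w : InfinitePlace K // IsReal w}) : ℂ :=
  if h : ∃ β : 𝓞 K, β ≠ 0 ∧ signSet (mixedEmbedding K (β : K)) = s then thetaVal ν m h.choose else 0

/-- **`ν((β)) = Θ_ν(signs β) · e_m(ι β)`** for every `β ≠ 0`. [cite: Mitsui1956, §1] -/
theorem apply_span_eq_signTheta_mul {ν : Ideal (𝓞 K) →*₀ ℂ} {m : Fin (rank K) → ℝ}
    (h : IsConeChar K ν m) {β : 𝓞 K} (hβ : β ≠ 0) :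
    ν (Ideal.span {β}) =
      signTheta ν m (signSet (mixedEmbedding K (β : K))) * eTwist m (mixedEmbedding K (β : K)) := by
  have hex : ∃ β' : 𝓞 K, β' ≠ 0 ∧ signSet (mixedEmbedding K (β' : K)) = signSet (mixedEmbedding K (β : K)) :=
    ⟨β, hβ, rfl⟩
  rw [signTheta, dif_pos hex, ← thetaVal_eq_of_signSet_eq h hβ hex.choose_spec.1 hex.choose_spec.2.symm]
  unfold thetaVal
  rw [mul_assoc, mul_comm (conj _), eTwist_mul_conj, mul_one]

/-- `|Θ_ν(s)| ≤ 1`. [folklore] -/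
theorem norm_signTheta_le {ν : Ideal (𝓞 K) →*₀ ℂ} {m : Fin (rank K) → ℝ} (h : IsConeChar K ν m)
    (s : Set {w : InfinitePlace K // IsReal w}) : ‖signTheta ν m s‖ ≤ 1 := by
  unfold signTheta
  split_ifs with hex
  · unfold thetaVal
    rw [norm_mul, Complex.norm_conj, norm_eTwist, mul_one]
    exact h.norm_le_one _
  · rw [norm_zero]; exact zero_le_one

/-! ## Roots of unity of a field with a real place -/

/-- **The roots of unity of a number field with a real place are `±1`** (a root of unity is
real at a real place, hence `±1` there, so its square is `1`). [folklore] -/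
theorem torsion_eq_one_or_neg_one (hr : 0 < nrRealPlaces K) (x : torsion K) :
    (x : (𝓞 K)ˣ) = 1 ∨ (x : (𝓞 K)ˣ) = -1 := by
  -- a real place
  obtain ⟨w⟩ : Nonempty {w : InfinitePlace K // IsReal w} := by
    rw [nrRealPlaces] at hr; exact Fintype.card_pos_iff.1 hr
  set φ : K →+* ℝ := embedding_of_isReal w.2 with hφ
  set u : (𝓞 K)ˣ := (x : (𝓞 K)ˣ) with hu
  -- `u` has finite order `n`, so `φ(u)^n = 1` and `φ(u) = ±1`
  have hfin : IsOfFinOrder u := (CommGroup.mem_torsion _).1 x.2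
  set n := orderOf u with hn
  have hn0 : 0 < n := hfin.orderOf_pos
  have hpow : ((u : 𝓞 K) : K) ^ n = 1 := by
    have := pow_orderOf_eq_one u
    rw [← hn] at this
    have h2 := congrArg (fun v : (𝓞 K)ˣ ↦ ((v : 𝓞 K) : K)) this
    simpa using h2
  have hφn : (φ ((u : 𝓞 K) : K)) ^ n = 1 := by rw [← map_pow, hpow, map_one]
  have habs : |φ ((u : 𝓞 K) : K)| = 1 := by
    have h := congrArg (fun r : ℝ ↦ |r|) hφn
    simp only [abs_pow, abs_one] at h
    exact (pow_eq_one_iff_of_nonneg (abs_nonneg _) hn0.ne').1 h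
  have hsq : φ (((u : 𝓞 K) : K) ^ 2) = 1 := by
    rw [map_pow, ← sq_abs, habs, one_pow]
  have hsq' : ((u : 𝓞 K) : K) ^ 2 = 1 := by
    have : φ (((u : 𝓞 K) : K) ^ 2 - 1) = 0 := by rw [map_sub, hsq, map_one, sub_self]
    rwa [map_eq_zero, sub_eq_zero] at this
  have hK : ((u : 𝓞 K) : K) = 1 ∨ ((u : 𝓞 K) : K) = -1 := by
    have : (((u : 𝓞 K) : K) - 1) * (((u : 𝓞 K) : K) + 1) = 0 := by ring_nf; rw [hsq']; ring
    rcases mul_eq_zero.1 this with h | h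
    · left; exact sub_eq_zero.1 h
    · right; exact eq_neg_of_add_eq_zero_left h
  rcases hK with h | h
  · left
    apply Units.ext
    have : ((u : 𝓞 K) : K) = ((1 : (𝓞 K)ˣ) : 𝓞 K) := by rw [h]; simp
    exact RingOfIntegers.ext this
  · right
    apply Units.ext
    have : ((u : 𝓞 K) : K) = (((-1 : (𝓞 K)ˣ) : 𝓞 K) : K) := by rw [h]; simp
    exact RingOfIntegers.ext this

/-- A totally real field has a real place. [folklore] -/
theorem nrRealPlaces_pos [IsTotallyReal K] : 0 < nrRealPlaces K := by
  rw [nrRealPlaces]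
  obtain ⟨w⟩ := (inferInstance : Nonempty (InfinitePlace K))
  exact Fintype.card_pos_iff.2 ⟨⟨w, IsTotallyReal.isReal w⟩⟩

/-! ## Generators in the cone -/

variable (K) in
/-- The integers whose embedding lies in the fundamental cone with norm `≤ X`. [folklore] -/
def coneSet (X : ℝ) : Set (𝓞 K) :=
  {β | mixedEmbedding K (β : K) ∈ fundamentalCone K ∧ mixedEmbedding.norm (mixedEmbedding K (β : K)) ≤ X}

/-- The cone points of bounded norm form a finite set (a bounded piece of the lattice `ι(𝓞 K)`).
[folklore] -/
theorem coneSet_finite (X : ℝ) : (coneSet K X).Finite := by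
  -- the embeddings lie in the bounded set `t • normLeOne`, `t^d ≥ X`
  set t : ℝ := max 1 X with ht
  have ht1 : 1 ≤ t := le_max_left _ _
  have ht0 : 0 < t := by linarith
  have hsub : (fun β : 𝓞 K ↦ mixedEmbedding K (β : K)) '' coneSet K X ⊆
      (t • normLeOne K) ∩ (mixedEmbedding.integerLattice K : Set (mixedSpace K)) := by
    rintro _ ⟨β, ⟨hβc, hβn⟩, rfl⟩
    refine ⟨?_, ⟨β, rfl⟩⟩
    rw [Set.mem_smul_set_iff_inv_smul_mem₀ ht0.ne', mem_normLeOne]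
    refine ⟨smul_mem_of_mem hβc (inv_ne_zero ht0.ne'), ?_⟩
    rw [mixedEmbedding.norm_smul, abs_inv, abs_of_pos ht0, inv_pow]
    have hd : 1 ≤ finrank ℚ K := finrank_pos
    have htd : X ≤ t ^ finrank ℚ K := (le_max_right 1 X).trans (le_self_pow₀ ht1 (by omega))
    have hnn := mixedEmbedding.norm_nonneg (mixedEmbedding K (β : K))
    rw [inv_mul_le_iff₀ (by positivity), mul_one]
    exact hβn.trans htd
  have hfin : ((t • normLeOne K) ∩ (mixedEmbedding.integerLattice K : Set (mixedSpace K))).Finite := by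
    have hb : IsBounded (t • normLeOne K) := (isBounded_normLeOne K).smul₀ t
    have := ZSpan.setFinite_inter (mixedEmbedding.latticeBasis K) hb
    rwa [mixedEmbedding.span_latticeBasis] at this
  refine Set.Finite.of_finite_image (hfin.subset hsub) ?_
  intro a _ b _ hab
  exact RingOfIntegers.ext ((mixedEmbedding_injective K) hab)

variable (K) in
/-- **The cone points of `J` of norm `≤ X`**: the `β ∈ J` whose embedding lies in the fundamental
cone with `N(ι β) ≤ X` (each nonzero principal ideal `⊆ J` of norm `≤ X` has exactly two such
generators, `sum_conePts_eq_two_mul_sum`). [cite: Marcus2018, Ch. 6, proof of Theorem 39] -/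
def conePts (J : Ideal (𝓞 K)) (X : ℝ) : Finset (𝓞 K) :=
  (coneSet_finite (K := K) X).toFinset.filter fun β ↦ β ∈ J

/-- Membership in `conePts`. [folklore] -/
theorem mem_conePts {J : Ideal (𝓞 K)} {X : ℝ} {β : 𝓞 K} :
    β ∈ conePts K J X ↔ β ∈ J ∧ mixedEmbedding K (β : K) ∈ fundamentalCone K ∧
      mixedEmbedding.norm (mixedEmbedding K (β : K)) ≤ X := by
  rw [conePts, Finset.mem_filter, Set.Finite.mem_toFinset, coneSet, Set.mem_setOf_eq]
  tauto

/-- Cone points are nonzero. [folklore] -/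
theorem ne_zero_of_mem_conePts {J : Ideal (𝓞 K)} {X : ℝ} {β : 𝓞 K} (h : β ∈ conePts K J X) : β ≠ 0 := by
  intro h0
  have := norm_pos_of_mem (mem_conePts.1 h).2.1
  rw [h0] at this
  simp at this

omit [NumberField K] in
/-- The embedding of `−β`. [folklore] -/
theorem mixedEmbedding_neg_coe (β : 𝓞 K) :
    mixedEmbedding K ((-β : 𝓞 K) : K) = (-1 : ℝ) • mixedEmbedding K (β : K) := by
  rw [neg_one_smul, ← map_neg]; push_cast; rfl

/-- `−β` is a cone point with `β`. [folklore] -/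
theorem neg_mem_conePts {J : Ideal (𝓞 K)} {X : ℝ} {β : 𝓞 K} (h : β ∈ conePts K J X) : -β ∈ conePts K J X := by
  obtain ⟨hJ, hc, hn⟩ := mem_conePts.1 h
  refine mem_conePts.2 ⟨J.neg_mem hJ, ?_, ?_⟩
  · rw [mixedEmbedding_neg_coe]
    exact smul_mem_of_mem hc (by norm_num)
  · rw [mixedEmbedding_neg_coe, mixedEmbedding.norm_smul]
    simpa using hn

variable (K) in
/-- The nonzero principal ideals `I ⊆ J` of norm `≤ X`. [folklore] -/
def princIdeals (J : Ideal (𝓞 K)) (X : ℝ) : Finset (Ideal (𝓞 K)) :=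
  (NumberField.idealsLE K X).filter fun I ↦ I.IsPrincipal ∧ I ≤ J

/-- Membership in `princIdeals`. [folklore] -/
theorem mem_princIdeals {J I : Ideal (𝓞 K)} {X : ℝ} :
    I ∈ princIdeals K J X ↔ I ≠ ⊥ ∧ (Ideal.absNorm I : ℝ) ≤ X ∧ I.IsPrincipal ∧ I ≤ J := by
  rw [princIdeals, Finset.mem_filter, NumberField.mem_idealsLE]
  tauto

/-- The norm of the embedding of an integer is the absolute norm of the ideal it generates.
[folklore] -/
theorem norm_mixedEmbedding_eq_absNorm (β : 𝓞 K) :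
    mixedEmbedding.norm (mixedEmbedding K (β : K)) = (Ideal.absNorm (Ideal.span {β}) : ℝ) := by
  rw [norm_eq_norm, Ideal.absNorm_span_singleton, ← Algebra.coe_norm_int, ← Int.cast_abs, Int.abs_eq_natAbs,
    Int.cast_natCast, Rat.cast_natCast]

/-- A cone point of `J` of norm `≤ X` generates an ideal of `princIdeals J X`. [folklore] -/
theorem span_mem_princIdeals {J : Ideal (𝓞 K)} {X : ℝ} {β : 𝓞 K} (h : β ∈ conePts K J X) :
    Ideal.span {β} ∈ princIdeals K J X := by
  obtain ⟨hJ, hc, hn⟩ := mem_conePts.1 h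
  refine mem_princIdeals.2 ⟨?_, ?_, ⟨β, rfl⟩, ?_⟩
  · rw [ne_eq, Ideal.span_singleton_eq_bot]; exact ne_zero_of_mem_conePts h
  · rwa [← norm_mixedEmbedding_eq_absNorm]
  · rwa [Ideal.span_singleton_le_iff_mem]

/-- Every ideal of `princIdeals J X` has a generator in `conePts J X`.
[cite: Marcus2018, Ch. 6, proof of Theorem 39] -/
theorem exists_mem_conePts_span_eq {J I : Ideal (𝓞 K)} {X : ℝ} (h : I ∈ princIdeals K J X) :
    ∃ β ∈ conePts K J X, Ideal.span {β} = I := by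
  obtain ⟨hI, hn, ⟨γ, hγ⟩, hIJ⟩ := mem_princIdeals.1 h
  rw [Ideal.submodule_span_eq] at hγ
  have hγ0 : γ ≠ 0 := by rintro rfl; exact hI (by rw [hγ, Ideal.span_singleton_eq_bot])
  have hγK : (γ : K) ≠ 0 := RingOfIntegers.coe_ne_zero_iff.mpr hγ0
  obtain ⟨u, hu⟩ := exists_unit_smul_mem (norm_mixedEmbedding_ne_zero (K := K) hγK)
  refine ⟨u * γ, mem_conePts.2 ⟨?_, ?_, ?_⟩, ?_⟩
  · have : γ ∈ J := by rw [hγ] at hIJ; exact (Ideal.span_singleton_le_iff_mem _).1 hIJ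
    exact J.mul_mem_left _ this
  · rwa [unitSMul_smul, ← map_mul] at hu
  · rw [norm_mixedEmbedding_eq_absNorm, Ideal.span_singleton_mul_left_unit u.isUnit, ← hγ]
    exact hn
  · rw [Ideal.span_singleton_mul_left_unit u.isUnit, hγ]

/-- **Two cone generators of the same ideal differ by a sign** (`K` with a real place: the only
roots of unity are `±1`). [cite: Marcus2018, Ch. 6, proof of Theorem 39] -/
theorem eq_or_eq_neg_of_span_eq (hr : 0 < nrRealPlaces K) {J : Ideal (𝓞 K)} {X : ℝ} {β β' : 𝓞 K}
    (hβ : β ∈ conePts K J X) (hβ' : β' ∈ conePts K J X) (h : Ideal.span {β'} = Ideal.span {β}) :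
    β' = β ∨ β' = -β := by
  rw [Ideal.span_singleton_eq_span_singleton] at h
  obtain ⟨u, rfl⟩ := h.symm
  have hc := (mem_conePts.1 hβ).2.1
  have hc' := (mem_conePts.1 hβ').2.1
  have hu : u • mixedEmbedding K (β : K) ∈ fundamentalCone K := by
    rw [unitSMul_smul, ← map_mul]
    push_cast at hc'
    rwa [mul_comm] at hc'
  rw [unit_smul_mem_iff_mem_torsion hc] at hu
  rcases torsion_eq_one_or_neg_one hr ⟨u, hu⟩ with h1 | h1
  · left; simp only at h1; rw [h1]; simp
  · right; simp only at h1; rw [h1]; simp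

/-- **The cone points cover each principal ideal exactly twice**: for every function `f` on ideals,
`∑_{β ∈ conePts J X} f((β)) = 2 ∑_{I ∈ princIdeals J X} f(I)`.
[cite: Marcus2018, Ch. 6, proof of Theorem 39] -/
theorem sum_conePts_eq_two_mul_sum (hr : 0 < nrRealPlaces K) (J : Ideal (𝓞 K)) (X : ℝ) (f : Ideal (𝓞 K) → ℂ) :
    ∑ β ∈ conePts K J X, f (Ideal.span {β}) = 2 * ∑ I ∈ princIdeals K J X, f I := by
  rw [Finset.sum_comp]
  have himage : (conePts K J X).image (fun β ↦ Ideal.span {β}) = princIdeals K J X := by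
    ext I
    rw [Finset.mem_image]
    constructor
    · rintro ⟨β, hβ, rfl⟩; exact span_mem_princIdeals hβ
    · intro hI; exact exists_mem_conePts_span_eq hI
  rw [himage, Finset.mul_sum]
  refine Finset.sum_congr rfl fun I hI ↦ ?_
  obtain ⟨β, hβ, rfl⟩ := exists_mem_conePts_span_eq hI
  have hβ0 := ne_zero_of_mem_conePts hβ
  have hfib : (conePts K J X).filter (fun β' ↦ Ideal.span {β'} = Ideal.span {β}) = {β, -β} := by
    ext β'
    rw [Finset.mem_filter, Finset.mem_insert, Finset.mem_singleton]
    constructor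
    · rintro ⟨hβ', hspan⟩; exact eq_or_eq_neg_of_span_eq hr hβ hβ' hspan
    · rintro (rfl | rfl)
      · exact ⟨hβ, rfl⟩
      · exact ⟨neg_mem_conePts hβ, Ideal.span_singleton_neg β⟩
  have hne : β ≠ -β := fun h ↦ hβ0 (by
    have : (2 : 𝓞 K) * β = 0 := by rw [two_mul]; nth_rewrite 2 [h]; rw [add_neg_cancel]
    exact (mul_eq_zero.1 this).resolve_left two_ne_zero)
  rw [hfib, Finset.card_pair hne, nsmul_eq_mul, Nat.cast_ofNat]

/-! ## The dilated sign parts -/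

omit [NumberField K] in
/-- The sign set is invariant under positive scalings. [folklore] -/
theorem signSet_smul {x : mixedSpace K} {c : ℝ} (hc : 0 < c) : signSet (c • x) = signSet x := by
  ext w
  simp only [signSet, Set.mem_setOf_eq, Prod.smul_fst, Pi.smul_apply, smul_eq_mul]
  constructor
  · intro h
    by_contra h'
    push Not at h'
    exact absurd h (not_le.2 (mul_pos hc h'))
  · intro h
    exact mul_nonpos_of_nonneg_of_nonpos hc.le h

/-- **Membership in a dilated sign part**: for `t > 0`, `x ∈ t • X_s` iff `x` lies in the fundamental
cone, `N(x) ≤ t^d` and the negative real coordinates of `x` are exactly those in `s`. [folklore] -/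
theorem mem_smul_signPart_iff {s : Set {w : InfinitePlace K // IsReal w}} {t : ℝ} (ht : 0 < t)
    {x : mixedSpace K} :
    x ∈ t • signPart K s ↔
      x ∈ fundamentalCone K ∧ mixedEmbedding.norm x ≤ t ^ finrank ℚ K ∧ signSet x = s := by
  rw [Set.mem_smul_set_iff_inv_smul_mem₀ ht.ne']
  have hnorm : mixedEmbedding.norm (t⁻¹ • x) ≤ 1 ↔ mixedEmbedding.norm x ≤ t ^ finrank ℚ K := by
    rw [mixedEmbedding.norm_smul, abs_inv, abs_of_pos ht, inv_pow, inv_mul_le_iff₀ (by positivity), mul_one]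
  constructor
  · rintro ⟨z, ⟨hz, hzpos⟩, hzx⟩
    have hy : t⁻¹ • x ∈ normLeOne K := by rw [← hzx]; exact (negAt_mem_normLeOne_iff s).2 hz
    refine ⟨(smul_mem_iff_mem (inv_ne_zero ht.ne')).1 hy.1, hnorm.1 hy.2, ?_⟩
    rw [← signSet_smul (inv_pos.2 ht), ← hzx]
    ext w
    simp only [signSet, Set.mem_setOf_eq]
    by_cases hw : w ∈ s
    · rw [negAt_apply_isReal_and_mem _ hw]; exact ⟨fun _ ↦ hw, fun _ ↦ by linarith [hzpos w]⟩
    · rw [negAt_apply_isReal_and_notMem _ hw]; exact ⟨fun h ↦ absurd h (not_le.2 (hzpos w)), fun h ↦ absurd h hw⟩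
  · rintro ⟨hc, hn, hsign⟩
    have hy : t⁻¹ • x ∈ normLeOne K := ⟨smul_mem_of_mem hc (inv_ne_zero ht.ne'), hnorm.2 hn⟩
    have hsy : signSet (t⁻¹ • x) = s := by rw [signSet_smul (inv_pos.2 ht), hsign]
    refine ⟨negAt s (t⁻¹ • x), ⟨(negAt_mem_normLeOne_iff s).2 hy, fun w ↦ ?_⟩, ?_⟩
    · have hne : (t⁻¹ • x).1 w ≠ 0 := by
        have := normAtPlace_pos_of_mem hy.1 w.1
        rw [normAtPlace_apply_of_isReal w.2] at this
        exact norm_pos_iff.1 this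
      by_cases hw : w ∈ s
      · rw [negAt_apply_isReal_and_mem _ hw, Left.neg_pos_iff]
        have : (t⁻¹ • x).1 w ≤ 0 := by rw [← hsy] at hw; exact hw
        exact lt_of_le_of_ne this hne
      · rw [negAt_apply_isReal_and_notMem _ hw]
        have : ¬ (t⁻¹ • x).1 w ≤ 0 := by rw [← hsy] at hw; exact hw
        exact not_le.1 this
    · have h := (negAt s).apply_symm_apply (t⁻¹ • x)
      rwa [negAt_symm] at h

variable (K) in
/-- **The lattice points of `ι(J)` in the dilated sign part** `X^{1/d} • X_s`, as the embeddings of the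
cone points of `J` of norm `≤ X` with negative conjugates exactly at `s` (`mem_latticePts`).
[cite: Marcus2018, Ch. 6, proof of Theorem 39] -/
def latticePts (J : Ideal (𝓞 K)) (s : Set {w : InfinitePlace K // IsReal w}) (X : ℝ) : Finset (mixedSpace K) :=
  ((conePts K J X).filter fun β : 𝓞 K ↦ signSet (mixedEmbedding K (β : K)) = s).image
    fun β : 𝓞 K ↦ mixedEmbedding K (β : K)

/-- **Membership in `latticePts`**: the points of the ideal lattice of `J` in `X^{1/d} • X_s`.
[cite: Marcus2018, Ch. 6, proof of Theorem 39] -/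
theorem mem_latticePts {J : Ideal (𝓞 K)} (hJ : J ≠ ⊥) {X : ℝ} (hX : 0 < X)
    (s : Set {w : InfinitePlace K // IsReal w}) (x : mixedSpace K) :
    x ∈ latticePts K J s X ↔ x ∈ X ^ (1 / (finrank ℚ K : ℝ)) • signPart K s ∧
      x ∈ mixedEmbedding.idealLattice K (FractionalIdeal.mk0 K ⟨J, mem_nonZeroDivisors_of_ne_zero hJ⟩) := by
  set t : ℝ := X ^ (1 / (finrank ℚ K : ℝ)) with htdef
  have hd : (0 : ℝ) < finrank ℚ K := by exact_mod_cast finrank_pos (R := ℚ) (M := K)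
  have ht0 : 0 < t := Real.rpow_pos_of_pos hX _
  have htd : t ^ finrank ℚ K = X := by
    rw [htdef, ← Real.rpow_natCast, ← Real.rpow_mul hX.le, one_div_mul_cancel hd.ne', Real.rpow_one]
  rw [latticePts, Finset.mem_image]
  constructor
  · rintro ⟨β, hβ, rfl⟩
    obtain ⟨hβc, hsign⟩ := Finset.mem_filter.1 hβ
    obtain ⟨hβJ, hcone, hnorm⟩ := mem_conePts.1 hβc
    refine ⟨(mem_smul_signPart_iff ht0).2 ⟨hcone, htd ▸ hnorm, hsign⟩, ?_⟩
    rw [mem_idealLattice]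
    refine ⟨(β : K), ?_, rfl⟩
    change (β : K) ∈ ((FractionalIdeal.mk0 K ⟨J, _⟩ : (FractionalIdeal (𝓞 K)⁰ K)ˣ) : FractionalIdeal (𝓞 K)⁰ K)
    rw [FractionalIdeal.coe_mk0, FractionalIdeal.mem_coeIdeal]
    exact ⟨β, hβJ, rfl⟩
  · rintro ⟨hx, hxL⟩
    rw [mem_idealLattice] at hxL
    obtain ⟨y, hy, rfl⟩ := hxL
    have hy' : y ∈ ((FractionalIdeal.mk0 K ⟨J, mem_nonZeroDivisors_of_ne_zero hJ⟩ :
        (FractionalIdeal (𝓞 K)⁰ K)ˣ) : FractionalIdeal (𝓞 K)⁰ K) := hy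
    rw [FractionalIdeal.coe_mk0, FractionalIdeal.mem_coeIdeal] at hy'
    obtain ⟨β, hβJ, rfl⟩ := hy'
    obtain ⟨hcone, hnorm, hsign⟩ := (mem_smul_signPart_iff ht0).1 hx
    exact ⟨β, Finset.mem_filter.2 ⟨mem_conePts.2 ⟨hβJ, hcone, htd ▸ hnorm⟩, hsign⟩, rfl⟩

/-- The sum over the cone points with given signs is the sum over `latticePts`. [folklore] -/
theorem sum_conePts_filter_eq (J : Ideal (𝓞 K)) (X : ℝ) (s : Set {w : InfinitePlace K // IsReal w})
    (g : mixedSpace K → ℂ) :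
    ∑ β ∈ (conePts K J X).filter (fun β : 𝓞 K ↦ signSet (mixedEmbedding K (β : K)) = s),
        g (mixedEmbedding K (β : K)) = ∑ x ∈ latticePts K J s X, g x := by
  rw [latticePts, Finset.sum_image]
  intro a _ b _ hab
  exact RingOfIntegers.ext ((mixedEmbedding_injective K) hab)

/-! ## From the Dirichlet coefficients to the ideals, and the class decomposition -/

/-- `∑_{n ≤ x} twistCount ν n = ∑_{0 < N𝔞 ≤ x} ν(𝔞)`. [folklore] -/
theorem sum_Icc_twistCount_eq (ν : Ideal (𝓞 K) →*₀ ℂ) {x : ℝ} (hx : 0 ≤ x) :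
    ∑ n ∈ Finset.Icc 1 ⌊x⌋₊, NumberField.twistCount K ν n = ∑ I ∈ NumberField.idealsLE K x, ν I := by
  unfold NumberField.twistCount
  rw [← Finset.sum_biUnion]
  · refine Finset.sum_congr ?_ fun _ _ ↦ rfl
    ext I
    rw [Finset.mem_biUnion, NumberField.mem_idealsLE]
    constructor
    · rintro ⟨n, hn, hI⟩
      rw [Finset.mem_Icc] at hn
      rw [NumberField.mem_idealsOfNorm] at hI
      refine ⟨?_, ?_⟩
      · intro h; rw [h, Ideal.absNorm_bot] at hI; omega
      · rw [hI]; exact (Nat.cast_le.2 hn.2).trans (Nat.floor_le hx)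
    · rintro ⟨hI, hle⟩
      refine ⟨Ideal.absNorm I, Finset.mem_Icc.2 ⟨?_, (Nat.le_floor_iff hx).2 hle⟩, NumberField.mem_idealsOfNorm.2 rfl⟩
      exact Nat.one_le_iff_ne_zero.2 (by rwa [Ne, Ideal.absNorm_eq_zero_iff])
  · intro n _ n' _ hne
    rw [Function.onFun, Finset.disjoint_left]
    intro I hI hI'
    rw [NumberField.mem_idealsOfNorm] at hI hI'
    exact hne (hI.symm.trans hI')

/-- The ideal class of an ideal (junk value `1` at the zero ideal). [folklore] -/
def clsOf (I : Ideal (𝓞 K)) : ClassGroup (𝓞 K) :=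
  if h : I = ⊥ then 1 else ClassGroup.mk0 ⟨I, mem_nonZeroDivisors_of_ne_zero h⟩

/-- `clsOf` of a nonzero ideal. [folklore] -/
theorem clsOf_of_ne_bot {I : Ideal (𝓞 K)} (h : I ≠ ⊥) :
    clsOf I = ClassGroup.mk0 ⟨I, mem_nonZeroDivisors_of_ne_zero h⟩ := by
  rw [clsOf, dif_neg h]

/-- A nonzero integral ideal in the inverse of each class. [folklore] -/
theorem exists_classRep (C : ClassGroup (𝓞 K)) :
    ∃ J : Ideal (𝓞 K), ∃ hJ : J ≠ ⊥, ClassGroup.mk0 ⟨J, mem_nonZeroDivisors_of_ne_zero hJ⟩ = C⁻¹ := by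
  obtain ⟨J, hJ⟩ := ClassGroup.mk0_surjective C⁻¹
  refine ⟨J.1, nonZeroDivisors.ne_zero J.2, ?_⟩
  rw [← hJ]

/-- **The class representative `J_C ∈ C⁻¹`** (a nonzero integral ideal). [cite: Marcus2018, Ch. 6, proof of Theorem 39] -/
def classRep (C : ClassGroup (𝓞 K)) : Ideal (𝓞 K) := (exists_classRep C).choose

/-- `J_C ≠ 0`. [folklore] -/
theorem classRep_ne_bot (C : ClassGroup (𝓞 K)) : classRep C ≠ ⊥ := (exists_classRep C).choose_spec.1

/-- `[J_C] = C⁻¹`. [folklore] -/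
theorem mk0_classRep (C : ClassGroup (𝓞 K)) :
    ClassGroup.mk0 ⟨classRep C, mem_nonZeroDivisors_of_ne_zero (classRep_ne_bot C)⟩ = C⁻¹ :=
  (exists_classRep C).choose_spec.2

/-- The quotient of `I'` by a divisor `J` (junk `⊥` if `J ∤ I'`). [folklore] -/
def quotIdeal (I' J : Ideal (𝓞 K)) : Ideal (𝓞 K) := if h : J ∣ I' then h.choose else ⊥

omit [NumberField K] in
/-- `J * (I'/J) = I'` for `J ∣ I'`. [folklore] -/
theorem mul_quotIdeal {I' J : Ideal (𝓞 K)} (h : J ∣ I') : J * quotIdeal I' J = I' := by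
  rw [quotIdeal, dif_pos h]; exact h.choose_spec.symm

/-- **The ideals of a class of norm `≤ x` against the principal ideals `⊆ J_C` of norm `≤ x N(J_C)`**:
`∑_{[𝔞] = C, N𝔞 ≤ x} ν(𝔞) = conj ν(J_C) · ∑_{I ⊆ J_C principal, N I ≤ x N J_C} ν(I)` (`𝔞 ↦ 𝔞 J_C`).
[cite: Marcus2018, Ch. 6, proof of Theorem 39] -/
theorem sum_filter_clsOf_eq {ν : Ideal (𝓞 K) →*₀ ℂ} {m : Fin (rank K) → ℝ} (hν : IsConeChar K ν m)
    (C : ClassGroup (𝓞 K)) (x : ℝ) :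
    ∑ I ∈ (NumberField.idealsLE K x).filter (fun I ↦ clsOf I = C), ν I =
      conj (ν (classRep C)) * ∑ I' ∈ princIdeals K (classRep C) (x * Ideal.absNorm (classRep C)), ν I' := by
  set J := classRep C with hJdef
  have hJ : J ≠ ⊥ := classRep_ne_bot C
  have hJ0 : (J : Ideal (𝓞 K)) ≠ 0 := hJ
  have hNJ : 0 < (Ideal.absNorm J : ℝ) := by
    exact_mod_cast Nat.pos_of_ne_zero (by rwa [Ne, Ideal.absNorm_eq_zero_iff])
  rw [Finset.mul_sum]
  refine Finset.sum_nbij' (fun I ↦ I * J) (fun I' ↦ quotIdeal I' J) ?_ ?_ ?_ ?_ ?_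
  · intro I hI
    obtain ⟨hI, hcls⟩ := Finset.mem_filter.1 hI
    obtain ⟨hI0, hle⟩ := NumberField.mem_idealsLE.1 hI
    refine mem_princIdeals.2 ⟨mul_ne_zero hI0 hJ, ?_, ?_, Ideal.mul_le_left⟩
    · rw [map_mul, Nat.cast_mul]; exact mul_le_mul_of_nonneg_right hle hNJ.le
    · rw [← ClassGroup.mk0_eq_one_iff (mem_nonZeroDivisors_of_ne_zero (mul_ne_zero hI0 hJ))]
      have : (⟨I * J, mem_nonZeroDivisors_of_ne_zero (mul_ne_zero hI0 hJ)⟩ : (Ideal (𝓞 K))⁰) =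
          ⟨I, mem_nonZeroDivisors_of_ne_zero hI0⟩ * ⟨J, mem_nonZeroDivisors_of_ne_zero hJ⟩ := rfl
      rw [this, map_mul, mk0_classRep, ← clsOf_of_ne_bot hI0, hcls, mul_inv_cancel]
  · intro I' hI'
    obtain ⟨hI'0, hle, hprinc, hleJ⟩ := mem_princIdeals.1 hI'
    have hdvd : J ∣ I' := Ideal.dvd_iff_le.2 hleJ
    have hq := mul_quotIdeal hdvd
    have hq0 : quotIdeal I' J ≠ ⊥ := by
      intro h; rw [h, Ideal.mul_bot] at hq; exact hI'0 hq.symm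
    refine Finset.mem_filter.2 ⟨NumberField.mem_idealsLE.2 ⟨hq0, ?_⟩, ?_⟩
    · have hN : (Ideal.absNorm I' : ℝ) = Ideal.absNorm J * Ideal.absNorm (quotIdeal I' J) := by
        rw [← Nat.cast_mul, ← map_mul, hq]
      rw [hN] at hle
      nlinarith
    · rw [clsOf_of_ne_bot hq0]
      have h1 : ClassGroup.mk0 ⟨I', mem_nonZeroDivisors_of_ne_zero hI'0⟩ = 1 :=
        (ClassGroup.mk0_eq_one_iff _).2 hprinc
      have : (⟨I', mem_nonZeroDivisors_of_ne_zero hI'0⟩ : (Ideal (𝓞 K))⁰) =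
          ⟨J, mem_nonZeroDivisors_of_ne_zero hJ⟩ * ⟨quotIdeal I' J, mem_nonZeroDivisors_of_ne_zero hq0⟩ :=
        Subtype.ext hq.symm
      rw [this, map_mul, mk0_classRep] at h1
      exact (inv_mul_eq_one.1 h1).symm
  · intro I hI
    obtain ⟨hI, -⟩ := Finset.mem_filter.1 hI
    obtain ⟨hI0, -⟩ := NumberField.mem_idealsLE.1 hI
    have hdvd : J ∣ I * J := Dvd.intro I (mul_comm J I)
    have hq : J * quotIdeal (I * J) J = J * I := (mul_quotIdeal hdvd).trans (mul_comm I J)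
    exact mul_left_cancel₀ hJ0 hq
  · intro I' hI'
    obtain ⟨-, -, -, hleJ⟩ := mem_princIdeals.1 hI'
    have hq := mul_quotIdeal (Ideal.dvd_iff_le.2 hleJ)
    rw [mul_comm]; exact hq
  · intro I hI
    obtain ⟨hI, -⟩ := Finset.mem_filter.1 hI
    obtain ⟨hI0, -⟩ := NumberField.mem_idealsLE.1 hI
    rw [map_mul, mul_comm (conj _), mul_assoc, hν.mul_conj_eq_one hJ, mul_one]

/-- **The class decomposition** `∑_{0 < N𝔞 ≤ x} ν(𝔞) = ∑_C ∑_{[𝔞] = C, N𝔞 ≤ x} ν(𝔞)`. [folklore] -/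
theorem sum_idealsLE_eq_sum_classes (f : Ideal (𝓞 K) → ℂ) (x : ℝ) :
    ∑ I ∈ NumberField.idealsLE K x, f I =
      ∑ C : ClassGroup (𝓞 K), ∑ I ∈ (NumberField.idealsLE K x).filter (fun I ↦ clsOf I = C), f I :=
  (Finset.sum_fiberwise_of_maps_to (fun I _ ↦ Finset.mem_univ (clsOf I)) f).symm

/-- **Principal ideals `⊆ J` through the cone points and the signs**:
`∑_{I ⊆ J principal, N I ≤ X} ν(I) = ½ ∑_s Θ_ν(s) ∑_{ℓ ∈ latticePts J s X} e_m(ℓ)`.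
[cite: Mitsui1956, §1; Marcus2018, Ch. 6, proof of Theorem 39] -/
theorem sum_princIdeals_eq (hr : 0 < nrRealPlaces K) {ν : Ideal (𝓞 K) →*₀ ℂ} {m : Fin (rank K) → ℝ}
    (hν : IsConeChar K ν m) (J : Ideal (𝓞 K)) (X : ℝ) :
    ∑ I' ∈ princIdeals K J X, ν I' =
      2⁻¹ * ∑ s : Set {w : InfinitePlace K // IsReal w},
        signTheta ν m s * ∑ x ∈ latticePts K J s X, eTwist m x := by
  have h2 := sum_conePts_eq_two_mul_sum hr J X ν
  have hsum : ∑ β ∈ conePts K J X, ν (Ideal.span {β}) =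
      ∑ s : Set {w : InfinitePlace K // IsReal w}, signTheta ν m s * ∑ x ∈ latticePts K J s X, eTwist m x := by
    rw [← Finset.sum_fiberwise_of_maps_to (s := conePts K J X) (t := (Finset.univ : Finset (Set {w : InfinitePlace K // IsReal w})))
      (g := fun β : 𝓞 K ↦ signSet (mixedEmbedding K (β : K))) (fun β _ ↦ Finset.mem_univ _)]
    refine Finset.sum_congr rfl fun s _ ↦ ?_
    rw [← sum_conePts_filter_eq J X s, Finset.mul_sum]
    refine Finset.sum_congr rfl fun β hβ ↦ ?_
    obtain ⟨hβc, hsign⟩ := Finset.mem_filter.1 hβ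
    rw [apply_span_eq_signTheta_mul hν (ne_zero_of_mem_conePts hβc), hsign]
  rw [← hsum, h2, ← mul_assoc, inv_mul_cancel₀ two_ne_zero, one_mul]

/-- **The partial sums of a cone character through twisted lattice sums**:
`∑_{n ≤ x} twistCount ν n = ∑_C conj ν(J_C) · ½ ∑_s Θ_ν(s) ∑_{ℓ ∈ latticePts J_C s (x N J_C)} e_m(ℓ)`
for a field with a real place. [cite: Mitsui1956, §1] -/
theorem sum_twistCount_eq (hr : 0 < nrRealPlaces K) {ν : Ideal (𝓞 K) →*₀ ℂ} {m : Fin (rank K) → ℝ}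
    (hν : IsConeChar K ν m) {x : ℝ} (hx : 0 ≤ x) :
    ∑ n ∈ Finset.Icc 1 ⌊x⌋₊, NumberField.twistCount K ν n =
      ∑ C : ClassGroup (𝓞 K), conj (ν (classRep C)) *
        (2⁻¹ * ∑ s : Set {w : InfinitePlace K // IsReal w},
          signTheta ν m s * ∑ ℓ ∈ latticePts K (classRep C) s (x * Ideal.absNorm (classRep C)), eTwist m ℓ) := by
  rw [sum_Icc_twistCount_eq ν hx, sum_idealsLE_eq_sum_classes]
  refine Finset.sum_congr rfl fun C _ ↦ ?_
  rw [sum_filter_clsOf_eq hν C x, sum_princIdeals_eq hr hν]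

end Literature.NumberTheory.LFunctions.HeckeCone

end
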